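import Summits.HubbardSuperconductivity.HubbardSuperconductivity.Theorems.ThermalWedgeTwSeededEnsembleEquivalenceBracketOfDifferentiableLimit
import Summits.HubbardSuperconductivity.HubbardSuperconductivity.Theorems.ThermalWedgeTwSeededEnsembleEquivalenceThermalCloser
import Summits.HubbardSuperconductivity.HubbardSuperconductivity.Theorems.ThermalWedgeTwSeededEnsembleEquivalenceThermalWalk
import Summits.HubbardSuperconductivity.HubbardSuperconductivity.Theorems.ThermalWedgeTwSeededEnsembleEquivalenceSectorTraceToolkit
import Summits.HubbardSuperconductivity.HubbardSuperconductivity.Theorems.ThermalWedgeTwSeededEnsembleEquivalenceCommutatorSums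
import Summits.HubbardSuperconductivity.HubbardSuperconductivity.Theorems.ThermalWedgeTwSeededRungThermalWindow

/-!
# Crux `TwSeededEnsembleEquivalence` (stmt-HubbardSuperconductivity-1698) — the crux, as filed and in its
# thermal-window restatement, FROM DIFFERENTIABILITY OF THE INFINITE-VOLUME SEEDED PRESSURE

Support file (`--supports stmt-HubbardSuperconductivity-1698`; no definition, nothing assumed; route-file free).
All six bookkeeping stubs A–F of the thermal member of line `exposed-density-duality` are in the tree
(`stub_sectorWeightBasics`, `stub_sectorTraceToolkit`, `stub_commutatorSums`, `stub_thermalWalk`,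
`stub_thermalCloser`, `stub_ahmTransfer`), and so is the bridge `stub_thermalBracket_of_differentiableLimit`
(`…BracketOfDifferentiableLimit.lean`). Composing them: the crux instance at `(δ, U, g, β)` holds at an
`L`-independent `μ₀` of the window as soon as the finite-volume seeded pressure `p_L(β, ·)` has a pointwise
limit `b` on `[μ₁, μ₂]` (TDL) that is differentiable on `(μ₁, μ₂)` (DIFF) with `b′(μ⁻) ≤ 1 − δ ≤ b′(μ⁺)` at two
interior points (EDGE). Hence
* `twSeededEnsembleEquivalence_of_differentiablePressure`: (TDL)+(DIFF)+(EDGE) for every `U ≤ U₀(δ)`,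
  `g ∈ (0, 1/10]`, `β ≥ 1` ⟹ the VERBATIM body of `TwSeededEnsembleEquivalence` (as filed);
* `tw_thermalWindowEnsemble_of_differentiablePressure`: the same on the thermal window `1 ≤ β ≤ e^{a/U}`,
  `g ∈ [K'U, 1/10]` (∃ a K' U₀) ⟹ the VERBATIM hypothesis `hEns` of `twSeededRung_structural_thermalWindow`;
* `twSeededRung_of_differentiablePressure`: hence, with crux `TwSourcedCondensation` as filed, the ANCHOR `TwSeededRung`
  (verbatim body) — the route's rungs from TWO engine statements about infinite-volume pressures.
So the physics of stmt-…-1698 (restated or not) is SUPPLIED BY the statement "the infinite-volume seeded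
pressure exists and has NO KINK on the δ-window" at the relevant `(U, g, β)` — for the mean-field seeded model, absence of a
first-order jump of the grand-canonical density across `1 − δ`; by `stub_seededLimit_of_sourcedLimit`
(`…SeededLimitOfSourcedLimit.lean`) (TDL) is in turn the thermodynamic limit of the short-range SOURCED pressure.
[folklore]
-/

set_option linter.dupNamespace false

namespace Summit.HubbardSuperconductivity.HubbardSuperconductivity.Theorems.TwSeededEnsembleEquivalence.ThermalDuality

open Matrix Filter Topology Finset Literature.MathematicalPhysics.QuantumLattice
open scoped ComplexOrder Matrix.Norms.L2Operator

noncomputable section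

/-- The walk hypothesis of the closer at the constant `C = 2(18(2+|U|) + gC₀)`, from the landed stubs B, C, D
(`stub_sectorTraceToolkit`, `stub_commutatorSums`, `stub_thermalWalk`); copy of the skeleton's
`thermalWalk_of_stubs`. [folklore] -/
theorem bdl_thermalWalk_of_stubs (U g β : ℝ) (hg : 0 ≤ g) (hβ : 0 ≤ β) :
    ∃ C : ℝ, 0 ≤ C ∧ ∀ (L : ℕ) [NeZero L] (N : ℕ),
        (1 ≤ N → N ≤ 2 * L ^ 2 →
          ∑ s ∈ (Finset.univ.filter fun s : Finset (Orb (FermionTorus 2 L)) => s.card = N),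
              (Matrix.gibbsWeight β (hubbardTorusWith 2 L 1 U 0 - ((g / (L : ℝ) ^ 2 : ℝ) : ℂ) • ((pairField dWaveFormFactor L)ᴴ * pairField dWaveFormFactor L)) s s).re ≤
            ((2 * (L : ℝ) ^ 2 - N + 1) / N) * Real.exp (β * (C * (L : ℝ) ^ 2) / N) *
              ∑ s ∈ (Finset.univ.filter fun s : Finset (Orb (FermionTorus 2 L)) => s.card = N - 1),
                (Matrix.gibbsWeight β (hubbardTorusWith 2 L 1 U 0 - ((g / (L : ℝ) ^ 2 : ℝ) : ℂ) • ((pairField dWaveFormFactor L)ᴴ * pairField dWaveFormFactor L)) s s).re) ∧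
        (N + 1 ≤ 2 * L ^ 2 →
          ∑ s ∈ (Finset.univ.filter fun s : Finset (Orb (FermionTorus 2 L)) => s.card = N),
              (Matrix.gibbsWeight β (hubbardTorusWith 2 L 1 U 0 - ((g / (L : ℝ) ^ 2 : ℝ) : ℂ) • ((pairField dWaveFormFactor L)ᴴ * pairField dWaveFormFactor L)) s s).re ≤
            ((N + 1) / (2 * (L : ℝ) ^ 2 - N)) * Real.exp (β * (C * (L : ℝ) ^ 2) / (2 * (L : ℝ) ^ 2 - N)) *
              ∑ s ∈ (Finset.univ.filter fun s : Finset (Orb (FermionTorus 2 L)) => s.card = N + 1),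
                (Matrix.gibbsWeight β (hubbardTorusWith 2 L 1 U 0 - ((g / (L : ℝ) ^ 2 : ℝ) : ℂ) • ((pairField dWaveFormFactor L)ᴴ * pairField dWaveFormFactor L)) s s).re) := by
  obtain ⟨C₀, hC₀, hcomm⟩ := stub_commutatorSums
  refine ⟨2 * (18 * (2 + |U|) + g * C₀), by positivity, fun L _ N => ?_⟩
  obtain ⟨hJ, hM⟩ := stub_sectorTraceToolkit L
  obtain ⟨h1, h2⟩ := hcomm L U g hg
  have hR : (18 * (2 + |U|) + g * C₀) * (2 * (L : ℝ) ^ 2) = 2 * (18 * (2 + |U|) + g * C₀) * (L : ℝ) ^ 2 := by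
    ring
  rw [hR] at h1 h2
  exact stub_thermalWalk L U g β (2 * (18 * (2 + |U|) + g * C₀) * (L : ℝ) ^ 2) hβ hJ hM h1 h2 N

/-- **The crux instance from the secant bracket** (stubs A–E): at `(δ, U, g, β, μ₀)` with `δ` in the window,
`β ≥ 1`, `g ≥ 0`, the two-sided secant bracket `hBr` of the seeded pressure at `μ₀` gives the crux instance for
every `ε > 0`, eventually in `L`. [folklore] -/
theorem bdl_cruxInstance_of_bracket (δ U g β μ₀ : ℝ) (hδ : δ ∈ Set.Icc (1/10 : ℝ) (2/5 : ℝ)) (hβ : 1 ≤ β)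
    (hg : 0 ≤ g)
    (hbr : (∀ η : ℝ, 0 < η → ∃ τ : ℝ, 0 < τ ∧ ∃ L₀ : ℕ, ∀ (L : ℕ) [NeZero L], L₀ ≤ L →
        ((Real.log (Matrix.partitionFn β (hubbardTorusWith 2 L 1 U (μ₀ + τ) - ((g / (L : ℝ) ^ 2 : ℝ) : ℂ) • ((pairField dWaveFormFactor L)ᴴ * pairField dWaveFormFactor L))).re / (β * (L : ℝ) ^ 2)) -
          (Real.log (Matrix.partitionFn β (hubbardTorusWith 2 L 1 U μ₀ - ((g / (L : ℝ) ^ 2 : ℝ) : ℂ) • ((pairField dWaveFormFactor L)ᴴ * pairField dWaveFormFactor L))).re / (β * (L : ℝ) ^ 2))) / τ ≤ (1 - δ) + η ∧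
        (1 - δ) - η ≤ ((Real.log (Matrix.partitionFn β (hubbardTorusWith 2 L 1 U μ₀ - ((g / (L : ℝ) ^ 2 : ℝ) : ℂ) • ((pairField dWaveFormFactor L)ᴴ * pairField dWaveFormFactor L))).re / (β * (L : ℝ) ^ 2)) -
          (Real.log (Matrix.partitionFn β (hubbardTorusWith 2 L 1 U (μ₀ - τ) - ((g / (L : ℝ) ^ 2 : ℝ) : ℂ) • ((pairField dWaveFormFactor L)ᴴ * pairField dWaveFormFactor L))).re / (β * (L : ℝ) ^ 2))) / τ)) :
    ∀ ε : ℝ, 0 < ε → ∃ L₀ : ℕ, ∀ (L : ℕ) [NeZero L], L₀ ≤ L →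
      ((hubbardTorus 2 L 1 U - ((g / (L : ℝ) ^ 2 : ℝ) : ℂ) • ((pairField dWaveFormFactor L)ᴴ * pairField dWaveFormFactor L)).minEnergyOn (szSector (Λ := FermionTorus 2 L) (2 * ⌊(1 - δ) * (L : ℝ) ^ 2 / 2⌋₊) 0) / (L : ℝ) ^ 2) + (Real.log (Matrix.partitionFn β (hubbardTorusWith 2 L 1 U μ₀ - ((g / (L : ℝ) ^ 2 : ℝ) : ℂ) • ((pairField dWaveFormFactor L)ᴴ * pairField dWaveFormFactor L))).re / (β * (L : ℝ) ^ 2)) - μ₀ * ((2 * ⌊(1 - δ) * (L : ℝ) ^ 2 / 2⌋₊) : ℝ) / (L : ℝ) ^ 2 ≤ Real.log 4 / β + ε := by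
  have hβ0 : 0 < β := lt_of_lt_of_le one_pos hβ
  obtain ⟨C, hC, hwalk⟩ := bdl_thermalWalk_of_stubs U g β hg hβ0.le
  exact stub_thermalCloser δ U g β μ₀ C hδ hβ hC (fun L _ => stub_sectorWeightBasics L U g β hβ0) hwalk hbr

/-- **The crux instance from (TDL) + (DIFF) + (EDGE)** at `(δ, U, g, β)`: some `L`-independent `μ₀ ∈ [μ₁, μ₂]`
carries the crux instance for every `ε > 0`. [folklore] -/
theorem bdl_cruxInstance_of_differentiablePressure (δ U g β μ₁ μ₂ : ℝ) (hδ : δ ∈ Set.Icc (1/10 : ℝ) (2/5 : ℝ))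
    (hβ : 1 ≤ β) (hg : 0 ≤ g)
    (hP : ∃ (b : ℝ → ℝ) (μm μp : ℝ),
          (∀ μ ∈ Set.Icc μ₁ μ₂, ∀ κ : ℝ, 0 < κ → ∃ L₀ : ℕ, ∀ (L : ℕ) [NeZero L], L₀ ≤ L →
            |Real.log (Matrix.partitionFn β (hubbardTorusWith 2 L 1 U μ - ((g / (L : ℝ) ^ 2 : ℝ) : ℂ) • ((pairField dWaveFormFactor L)ᴴ * pairField dWaveFormFactor L))).re / (β * (L : ℝ) ^ 2) - b μ| ≤ κ) ∧
          (∀ μ ∈ Set.Ioo μ₁ μ₂, DifferentiableAt ℝ b μ) ∧ μm ∈ Set.Ioo μ₁ μ₂ ∧ μp ∈ Set.Ioo μ₁ μ₂ ∧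
          deriv b μm ≤ 1 - δ ∧ 1 - δ ≤ deriv b μp) :
    ∃ μ₀ ∈ Set.Icc μ₁ μ₂, ∀ ε : ℝ, 0 < ε → ∃ L₀ : ℕ, ∀ (L : ℕ) [NeZero L], L₀ ≤ L →
      ((hubbardTorus 2 L 1 U - ((g / (L : ℝ) ^ 2 : ℝ) : ℂ) • ((pairField dWaveFormFactor L)ᴴ * pairField dWaveFormFactor L)).minEnergyOn (szSector (Λ := FermionTorus 2 L) (2 * ⌊(1 - δ) * (L : ℝ) ^ 2 / 2⌋₊) 0) / (L : ℝ) ^ 2) + (Real.log (Matrix.partitionFn β (hubbardTorusWith 2 L 1 U μ₀ - ((g / (L : ℝ) ^ 2 : ℝ) : ℂ) • ((pairField dWaveFormFactor L)ᴴ * pairField dWaveFormFactor L))).re / (β * (L : ℝ) ^ 2)) - μ₀ * ((2 * ⌊(1 - δ) * (L : ℝ) ^ 2 / 2⌋₊) : ℝ) / (L : ℝ) ^ 2 ≤ Real.log 4 / β + ε := by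
  obtain ⟨b, μm, μp, hlim, hdiff, hm, hp, hdm, hdp⟩ := hP
  obtain ⟨μ₀, hμ₀, -, -, hbr⟩ :=
    tw_seededSecantBracket_of_differentiableLimit δ U g β μ₁ μ₂ μm μp b hlim hdiff hm hp hdm hdp
  exact ⟨μ₀, hμ₀, bdl_cruxInstance_of_bracket δ U g β μ₀ hδ hβ hg hbr⟩

/-- **`TwSeededEnsembleEquivalence` AS FILED from differentiability of the infinite-volume seeded pressure.**
If for every `δ` in the window there are a `δ`-window `[μ₁, μ₂] ⊂ (−4, 0)` and `U₀ > 0` such that for all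
`U ∈ (0, U₀]`, `g ∈ (0, 1/10]`, `β ≥ 1` the seeded pressure has a pointwise limit on `[μ₁, μ₂]` (TDL) that is
differentiable on `(μ₁, μ₂)` (DIFF) with slopes bracketing `1 − δ` at two interior points (EDGE), then the
verbatim body of the crux holds. (For `β → ∞` at fixed `g` this hypothesis carries the crux's T = 0 content;
the in-class form is `tw_thermalWindowEnsemble_of_differentiablePressure`.) [folklore] -/
theorem twSeededEnsembleEquivalence_of_differentiablePressure :
    (∀ δ ∈ Set.Icc (1/10 : ℝ) (2/5 : ℝ), ∃ μ₁ μ₂ : ℝ, -4 < μ₁ ∧ μ₁ ≤ μ₂ ∧ μ₂ < 0 ∧ ∃ U₀ : ℝ, 0 < U₀ ∧ ∀ U ∈ Set.Ioc (0 : ℝ) U₀, ∀ g ∈ Set.Ioc (0 : ℝ) (1 / 10), ∀ β : ℝ, 1 ≤ β → ∃ (b : ℝ → ℝ) (μm μp : ℝ), (∀ μ ∈ Set.Icc μ₁ μ₂, ∀ κ : ℝ, 0 < κ → ∃ L₀ : ℕ, ∀ (L : ℕ) [NeZero L], L₀ ≤ L → |Real.log (Matrix.partitionFn β (Literature.MathematicalPhysics.QuantumLattice.hubbardTorusWith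 2 L 1 U μ - ((g / (L : ℝ) ^ 2 : ℝ) : ℂ) • ((Literature.MathematicalPhysics.QuantumLattice.pairField Literature.MathematicalPhysics.QuantumLattice.dWaveFormFactor L)ᴴ * Literature.MathematicalPhysics.QuantumLattice.pairField Literature.MathematicalPhysics.QuantumLattice.dWaveFormFactor L))).re / (β * (L : ℝ) ^ 2) - b μ| ≤ κ) ∧ (∀ μ ∈ Set.Ioo μ₁ μ₂, DifferentiableAt ℝ b μ) ∧ μm ∈ Set.Ioo μ₁ μ₂ ∧ μp ∈ Set.Ioo μ₁ μ₂ ∧ deriv b μm ≤ 1 - δ ∧ 1 - δ ≤ deriv b μp) → ∀ δ ∈ Set.Icc (1/10 : ℝ) (2/5 : ℝ), ∃ μ₁ μ₂ : ℝ, -4 < μ₁ ∧ μ₁ ≤ μ₂ ∧ μ₂ < 0 ∧ ∃ U₀ : ℝ, 0 < U₀ ∧ ∀ U ∈ Set.Ioc (0 : ℝ) U₀, ∀ g ∈ Set.Ioc (0 : ℝ) (1 / 10), ∀ β : ℝ, 1 ≤ β → ∃ μ ∈ Set.Icc μ₁ μ₂, ∀ ε : ℝ, 0 < ε → ∃ L₀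 : ℕ, ∀ (L : ℕ) [NeZero L], L₀ ≤ L → (((Literature.MathematicalPhysics.QuantumLattice.hubbardTorus 2 L 1 U - ((g / (L : ℝ) ^ 2 : ℝ) : ℂ) • ((Literature.MathematicalPhysics.QuantumLattice.pairField Literature.MathematicalPhysics.QuantumLattice.dWaveFormFactor L)ᴴ * Literature.MathematicalPhysics.QuantumLattice.pairField Literature.MathematicalPhysics.QuantumLattice.dWaveFormFactor L))).minEnergyOn (Literature.MathematicalPhysics.QuantumLattice.szSector (Λ := Literature.MathematicalPhysics.QuantumLattice.FermionTorus 2 L) (2 * ⌊(1 - δ) * (L : ℝ) ^ 2 / 2⌋₊) 0) / (L : ℝ) ^ 2) + (Real.log (Matrix.partitionFn β (Literature.MathematicalPhysics.QuantumLattice.hubbardTorusWith 2 L 1 U μ - ((g / (L : ℝ) ^ 2 : ℝ) : ℂ) • ((Literature.MathematicalPhysics.QuantumLattice.pairField Literature.MathematicalPhysics.QuantumLattice.dWaveFormFactor L)ᴴ * Literature.MathematicalPhysics.QuantumLattice.pairField Literature.MathematicalPhysics.QuantumLattice.dWaveFormFactor L))).re / (β * (L : ℝ) ^ 2)) - μ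 * ((2 * ⌊(1 - δ) * (L : ℝ) ^ 2 / 2⌋₊) : ℝ) / (L : ℝ) ^ 2 ≤ Real.log 4 / β + ε := by
  intro hP δ hδ
  obtain ⟨μ₁, μ₂, hμ₁, hμ₁₂, hμ₂, U₀, hU₀, hmain⟩ := hP δ hδ
  refine ⟨μ₁, μ₂, hμ₁, hμ₁₂, hμ₂, U₀, hU₀, fun U hU g hg β hβ => ?_⟩
  exact bdl_cruxInstance_of_differentiablePressure δ U g β μ₁ μ₂ hδ hβ hg.1.le (hmain U hU g hg β hβ)

/-- **The THERMAL-WINDOW restatement (`hEns` of `twSeededRung_structural_thermalWindow`) from differentiability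
of the infinite-volume seeded pressure ON THE THERMAL WINDOW**: the same with `∃ a K' U₀`, `g ∈ [K'U, 1/10]`,
`1 ≤ β ≤ e^{a/U}` — the in-class form the route's engine consumes. [folklore] -/
theorem tw_thermalWindowEnsemble_of_differentiablePressure
    (hP : ∀ δ ∈ Set.Icc (1/10 : ℝ) (2/5 : ℝ), ∃ μ₁ μ₂ : ℝ, -4 < μ₁ ∧ μ₁ ≤ μ₂ ∧ μ₂ < 0 ∧
      ∃ a K' U₀ : ℝ, 0 < a ∧ 0 < K' ∧ 0 < U₀ ∧ ∀ U ∈ Set.Ioc (0 : ℝ) U₀,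
        ∀ g ∈ Set.Icc (K' * U) (1 / 10), ∀ β : ℝ, 1 ≤ β → β ≤ Real.exp (a / U) →
        ∃ (b : ℝ → ℝ) (μm μp : ℝ),
          (∀ μ ∈ Set.Icc μ₁ μ₂, ∀ κ : ℝ, 0 < κ → ∃ L₀ : ℕ, ∀ (L : ℕ) [NeZero L], L₀ ≤ L →
            |Real.log (Matrix.partitionFn β (hubbardTorusWith 2 L 1 U μ - ((g / (L : ℝ) ^ 2 : ℝ) : ℂ) • ((pairField dWaveFormFactor L)ᴴ * pairField dWaveFormFactor L))).re / (β * (L : ℝ) ^ 2) - b μ| ≤ κ) ∧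
          (∀ μ ∈ Set.Ioo μ₁ μ₂, DifferentiableAt ℝ b μ) ∧ μm ∈ Set.Ioo μ₁ μ₂ ∧ μp ∈ Set.Ioo μ₁ μ₂ ∧
          deriv b μm ≤ 1 - δ ∧ 1 - δ ≤ deriv b μp) :
    ∀ δ ∈ Set.Icc (1/10 : ℝ) (2/5 : ℝ), ∃ μ₁ μ₂ : ℝ, -4 < μ₁ ∧ μ₁ ≤ μ₂ ∧ μ₂ < 0 ∧
      ∃ a K' U₀ : ℝ, 0 < a ∧ 0 < K' ∧ 0 < U₀ ∧ ∀ U ∈ Set.Ioc (0 : ℝ) U₀,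
        ∀ g ∈ Set.Icc (K' * U) (1 / 10), ∀ β : ℝ, 1 ≤ β → β ≤ Real.exp (a / U) →
          ∃ μ ∈ Set.Icc μ₁ μ₂, ∀ ε : ℝ, 0 < ε → ∃ L₀ : ℕ, ∀ (L : ℕ) [NeZero L], L₀ ≤ L →
            ((hubbardTorus 2 L 1 U - ((g / (L : ℝ) ^ 2 : ℝ) : ℂ) •
              ((pairField dWaveFormFactor L)ᴴ * pairField dWaveFormFactor L)).minEnergyOn
                (szSector (Λ := FermionTorus 2 L) (2 * ⌊(1 - δ) * (L : ℝ) ^ 2 / 2⌋₊) 0) /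
                  (L : ℝ) ^ 2) +
              (Real.log (Matrix.partitionFn β (hubbardTorusWith 2 L 1 U μ -
                ((g / (L : ℝ) ^ 2 : ℝ) : ℂ) •
                  ((pairField dWaveFormFactor L)ᴴ * pairField dWaveFormFactor L))).re /
                    (β * (L : ℝ) ^ 2)) -
              μ * ((2 * ⌊(1 - δ) * (L : ℝ) ^ 2 / 2⌋₊) : ℝ) / (L : ℝ) ^ 2 ≤ Real.log 4 / β + ε := by
  intro δ hδ
  obtain ⟨μ₁, μ₂, hμ₁, hμ₁₂, hμ₂, a, K', U₀, ha, hK', hU₀, hmain⟩ := hP δ hδ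
  refine ⟨μ₁, μ₂, hμ₁, hμ₁₂, hμ₂, a, K', U₀, ha, hK', hU₀, fun U hU g hg β hβ hβa => ?_⟩
  have hg0 : 0 ≤ g := (mul_pos hK' hU.1).le.trans hg.1
  exact bdl_cruxInstance_of_differentiablePressure δ U g β μ₁ μ₂ hδ hβ hg0 (hmain U hU g hg β hβ hβa)

/-- **The ANCHOR `TwSeededRung` from the normal form and crux 1697 as filed.** Differentiability of the
infinite-volume seeded pressure on the thermal window ((TDL)+(DIFF)+(EDGE), hypothesis `hP` of
`tw_thermalWindowEnsemble_of_differentiablePressure`) and the sourced condensation bound `TwSourcedCondensation`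
(verbatim body, `hCond`) give the verbatim body of `TwSeededRung`, through the landed engine
`twSeededRung_structural_thermalWindow`. [folklore] -/
theorem twSeededRung_of_differentiablePressure
    (hP : ∀ δ ∈ Set.Icc (1/10 : ℝ) (2/5 : ℝ), ∃ μ₁ μ₂ : ℝ, -4 < μ₁ ∧ μ₁ ≤ μ₂ ∧ μ₂ < 0 ∧
      ∃ a K' U₀ : ℝ, 0 < a ∧ 0 < K' ∧ 0 < U₀ ∧ ∀ U ∈ Set.Ioc (0 : ℝ) U₀,
        ∀ g ∈ Set.Icc (K' * U) (1 / 10), ∀ β : ℝ, 1 ≤ β → β ≤ Real.exp (a / U) →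
        ∃ (b : ℝ → ℝ) (μm μp : ℝ),
          (∀ μ ∈ Set.Icc μ₁ μ₂, ∀ κ : ℝ, 0 < κ → ∃ L₀ : ℕ, ∀ (L : ℕ) [NeZero L], L₀ ≤ L →
            |Real.log (Matrix.partitionFn β (hubbardTorusWith 2 L 1 U μ - ((g / (L : ℝ) ^ 2 : ℝ) : ℂ) • ((pairField dWaveFormFactor L)ᴴ * pairField dWaveFormFactor L))).re / (β * (L : ℝ) ^ 2) - b μ| ≤ κ) ∧
          (∀ μ ∈ Set.Ioo μ₁ μ₂, DifferentiableAt ℝ b μ) ∧ μm ∈ Set.Ioo μ₁ μ₂ ∧ μp ∈ Set.Ioo μ₁ μ₂ ∧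
          deriv b μm ≤ 1 - δ ∧ 1 - δ ≤ deriv b μp)
    (hCond : ∀ μ₁ μ₂ : ℝ, -4 < μ₁ → μ₁ ≤ μ₂ → μ₂ < 0 → ∃ U₀ a c C h₀ : ℝ, 0 < U₀ ∧ 0 < a ∧ 0 < c ∧
      0 < C ∧ 0 < h₀ ∧ ∀ U : ℝ, 0 < U → U ≤ U₀ → ∀ β : ℝ, 1 ≤ β → β ≤ Real.exp (a / U) →
        ∀ μ ∈ Set.Icc μ₁ μ₂, ∃ L₀ : ℕ, ∀ (L : ℕ) [NeZero L], L₀ ≤ L → ∀ h : ℝ, |h| ≤ h₀ →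
          c * h ^ 2 * Real.log (1 / (|h| + 1 / β)) - C * h ^ 2 ≤
            (Real.log (Matrix.partitionFn β (dWaveSourceTorus L U μ h)).re / (β * (L : ℝ) ^ 2)) -
              (Real.log (Matrix.partitionFn β (dWaveSourceTorus L U μ 0)).re / (β * (L : ℝ) ^ 2))) :
    ∀ δ ∈ Set.Icc (1/10 : ℝ) (2/5 : ℝ), ∃ U₀ K : ℝ, 0 < U₀ ∧ 0 < K ∧ K * U₀ ≤ 1 / 20 ∧
      ∀ U ∈ Set.Ioc (0 : ℝ) U₀, (∀ g ∈ Set.Icc (K * U) (1 / 10), ∃ c : ℝ, 0 < c ∧ ∃ L₀ : ℕ,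
        ∀ (L : ℕ) [NeZero L], L₀ ≤ L → Even L →
          ∀ (ψ : Fock (Orb (FermionTorus 2 L))), star ψ ⬝ᵥ ψ = 1 →
            IsGroundStateInSector (hubbardTorus 2 L 1 U - ((g / (L : ℝ) ^ 2 : ℝ) : ℂ) •
              ((pairField dWaveFormFactor L)ᴴ * pairField dWaveFormFactor L))
                (2 * ⌊(1 - δ) * (L : ℝ) ^ 2 / 2⌋₊) 0 ψ →
            c * (L : ℝ) ^ 4 ≤
              (expect ((pairField dWaveFormFactor L)ᴴ * pairField dWaveFormFactor L) ψ).re) :=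
  Summit.HubbardSuperconductivity.HubbardSuperconductivity.Theorems.twSeededRung_structural_thermalWindow
    (tw_thermalWindowEnsemble_of_differentiablePressure hP) hCond

end

end Summit.HubbardSuperconductivity.HubbardSuperconductivity.Theorems.TwSeededEnsembleEquivalence.ThermalDuality
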